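import Literature.Computability.Cryptography.YaoAmplification
import Literature.Computability.Complexity.PlumbingBricks
import Literature.Computability.Complexity.IterateFPGrowth
import Literature.Computability.Complexity.CountingHierarchyProofs
import HarnessLib

/-!
# Yao's direct product is polynomial-time computable (discharge of `yaoFun_polyTime`)

`YaoAmplification.lean` proves S05 (`weakOWFExist_iff_OWFExist`) modulo two efficiency facts. This
file discharges the first, `yaoFun_polyTime_holds`: for polynomial-time `f` the direct product
`Yao.Params.g` — on `w` of length `m`, with block length `n = nOf m` and `t = t(n)` blocks, the pair
encoding `frames [pad f(x₁), …, pad f(x_t), suffix]` — is in `FP`. No machine is programmed: `g` is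
written as a pipeline of the plumbing bricks (`PlumbingBricks.lean`) and two clocked loops:

* `GProg.nOfFn w = 1^{nOf |w|}`: `|w|` rounds of "increment `k` while `M(k+1) ≤ |w|`"
  (`lenLeFn`, `iteFn`; `iterate_mem_FP`), correct for *every* parameter polynomial `q`
  (`GProg.iterate_nstep`, monotonicity of `M` only);
* the block loop on the state `⟨1ᴸ, ⟨1ⁿ, ⟨1^{p(n)}, ⟨1^{fuel}, ⟨rest, acc⟩⟩⟩⟩⟩`: while fuel lasts,
  move the next `n`-block of `rest` through `f`, `pad10Fn` and the pairing onto `acc`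
  (`GProg.roundFn`; `iterate_mem_FP_of_growth` of `IterateFPGrowth.lean`, the first component `1ᴸ`
  being a length budget `L(n) ≥ t(n), 2p(n), p_f(n)` that also clocks the loop; two truncations to
  multiples of `L` make the round's growth linear in `L` on *all* words and are invisible on the
  states of the computation, `GProg.roundFn_gState_succ`);
* `GProg.gFn_eq`: the pipeline computes `Params.g`; `yaoFun_polyTime_holds`.

## References

* O. Goldreich, *Foundations of Cryptography I*, CUP 2001, §2.3.1 ("Clearly, `g` can be computed in
  polynomial time (by an algorithm that breaks the input into blocks and applies `f` to each
  block)").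
* S. Arora, B. Barak, *Computational Complexity: A Modern Approach*, CUP 2009, §1.3, §1.4.1.
-/

namespace Literature.Computability.Cryptography

namespace Yao

open _root_.Computability Polynomial Complexity Complexity.Plumb Complexity.Brick Complexity.OracleCompose

namespace GProg

variable (P : Params)

/-! ### The block length `nOf |w|` by a clocked search -/

/-- The search step: `k ↦ k + 1` while `M(k+1) ≤ m`. [folklore] -/
def nstep (m k : ℕ) : ℕ := if P.M (k + 1) ≤ m then k + 1 else k

/-- The condition `[|w| + 1 ≤ M(k+1)]` (= "stop") on the state `⟨w, 1ᵏ⟩`. [folklore] -/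
noncomputable def nOfCond : List Bool → List Bool := lenLeFn P.M1poly ∘ fanoutFn sndF (List.cons true ∘ fstF)

/-- One round of the search on `⟨w, 1ᵏ⟩`. [folklore] -/
noncomputable def nOfRound : List Bool → List Bool := fanoutFn fstF (iteFn (nOfCond P) sndF (List.cons true ∘ sndF))

/-- Value of the condition. [folklore] -/
theorem nOfCond_state (w : List Bool) (k : ℕ) : nOfCond P (boolPair w (ones k)) = [decide (w.length + 1 ≤ P.M (k + 1))] := by
  simp [nOfCond, lenLeFn_boolPair]

/-- Value of the round. [folklore] -/
theorem nOfRound_state (w : List Bool) (k : ℕ) : nOfRound P (boolPair w (ones k)) = boolPair w (ones (nstep P w.length k)) := by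
  unfold nOfRound nstep
  rw [fanoutFn_apply, fstF_boolPair]
  by_cases h : P.M (k + 1) ≤ w.length
  · rw [iteFn_apply_false (by rw [nOfCond_state, decide_eq_false (by omega)]), if_pos h]
    simp [List.replicate_succ]
  · rw [iteFn_apply_true (by rw [nOfCond_state, decide_eq_true (by omega)]), if_neg h]
    simp

/-- Additive growth of the round. [folklore] -/
theorem length_nOfRound_le (w : List Bool) : (nOfRound P w).length ≤ w.length + 3 := by
  have h1 := length_boolUnpair_parts_le w
  unfold nOfRound
  rcases lenLeFn_eq_or P.M1poly (fanoutFn sndF (List.cons true ∘ fstF) w) with h | h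
  · rw [fanoutFn_apply, iteFn_apply_true (by simpa [nOfCond] using h)]
    simp only [length_boolPair, fstF, sndF]; omega
  · rw [fanoutFn_apply, iteFn_apply_false (by simpa [nOfCond] using h)]
    simp only [length_boolPair, fstF, sndF, Function.comp_apply, List.length_cons]; omega

/-- `M` is monotone (for every `q`). [folklore] -/
theorem M_mono {a b : ℕ} (hab : a ≤ b) : P.M a ≤ P.M b := by
  unfold Params.M Params.T
  have hq : P.q.eval a ≤ P.q.eval b := by
    induction P.q using Polynomial.induction_on' with
    | add p q hp hq => simpa [Polynomial.eval_add] using Nat.add_le_add hp hq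
    | monomial k c => simpa [Polynomial.eval_monomial] using Nat.mul_le_mul_left c (Nat.pow_le_pow_left hab k)
  exact Nat.mul_le_mul hab (Nat.mul_le_mul hab hq)

/-- **The search computes `nOf`**: after `j ≤ m` rounds the counter is `min j (nOf m)`. [folklore] -/
theorem iterate_nstep (m : ℕ) : ∀ j, j ≤ m → (nstep P m)^[j] 0 = min j (P.nOf m)
  | 0, _ => by simp
  | j + 1, hj => by
    rw [Function.iterate_succ_apply', iterate_nstep m j (by omega)]
    have hG1 : P.M (P.nOf m) ≤ m := M_nOf_le P m
    have hGm : P.nOf m ≤ m := Nat.findGreatest_le m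
    have hG2 : ∀ n, P.nOf m < n → n ≤ m → ¬ P.M n ≤ m := fun n h1 h2 =>
      Nat.findGreatest_is_greatest (P := fun k => P.M k ≤ m) h1 h2
    unfold nstep
    by_cases hjG : j < P.nOf m
    · rw [min_eq_left hjG.le, if_pos ((M_mono P (by omega)).trans hG1), min_eq_left (by omega)]
    · rw [min_eq_right (by omega), if_neg (hG2 _ (Nat.lt_succ_self _) (by omega)), min_eq_right (by omega)]

/-- Rounds of the search on a state. [folklore] -/
theorem iterate_nOfRound (w : List Bool) : ∀ j, (nOfRound P)^[j] (boolPair w (ones 0)) = boolPair w (ones ((nstep P w.length)^[j] 0))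
  | 0 => rfl
  | j + 1 => by rw [Function.iterate_succ_apply', iterate_nOfRound w j, nOfRound_state, Function.iterate_succ_apply']

/-- **`nOfFn w = 1^{nOf |w|}`.** [folklore] -/
noncomputable def nOfFn : List Bool → List Bool :=
  sndF ∘ (fun z => (nOfRound P)^[X.eval (boolUnpair z).1.length] z) ∘ fanoutFn id (fun _ => [])

/-- Value of `nOfFn`. [folklore] -/
theorem nOfFn_apply (w : List Bool) : nOfFn P w = ones (P.nOf w.length) := by
  have h := iterate_nOfRound P w w.length
  rw [iterate_nstep P w.length w.length le_rfl, min_eq_right (show P.nOf w.length ≤ w.length from Nat.findGreatest_le _)] at h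
  simp only [nOfFn, Function.comp_apply, fanoutFn_apply, id, boolUnpair_boolPair, eval_X]
  rw [show (boolPair w [] : List Bool) = boolPair w (ones 0) from rfl, h, sndF_boolPair]

/-- `nOfFn ∈ FP`. [folklore] -/
theorem nOfFn_mem_FP : nOfFn P ∈ FP :=
  comp_mem_FP sndF_mem_FP (comp_mem_FP
    (iterate_mem_FP (fanoutFn_mem_FP fstF_mem_FP (iteFn_mem_FP
      (comp_mem_FP (lenLeFn_mem_FP _) (fanoutFn_mem_FP sndF_mem_FP (comp_mem_FP (cons_mem_FP true) fstF_mem_FP)))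
      sndF_mem_FP (comp_mem_FP (cons_mem_FP true) sndF_mem_FP))) 3 (length_nOfRound_le P) X)
    (fanoutFn_mem_FP OracleCompose.id_mem_FP (const_mem_FP [])))

/-! ### The block loop -/

variable (L : Polynomial ℕ)

/-- The state of the block loop: length budget, block length, pad length, fuel, unread input,
accumulated output. [folklore] -/
def gState (Lv n Pn fuel : ℕ) (rest acc : List Bool) : List Bool :=
  boolPair (ones Lv) (boolPair (ones n) (boolPair (ones Pn) (boolPair (ones fuel) (boolPair rest acc))))

/-- The initial state from `w`: `⟨1^{L(n)}, ⟨1ⁿ, ⟨1^{p(n)}, ⟨1^{t(n)}, ⟨w, ε⟩⟩⟩⟩⟩`, `n = nOf |w|`. [folklore] -/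
noncomputable def initFn : List Bool → List Bool :=
  fanoutFn (polyFn L ∘ nOfFn P) (fanoutFn (nOfFn P) (fanoutFn (polyFn P.p ∘ nOfFn P)
    (fanoutFn (polyFn P.Tpoly ∘ nOfFn P) (fanoutFn id (fun _ => [])))))

/-- The image of the next block, cut to the budget: `(f (rest ↾ n)) ↾ L`. [folklore] -/
noncomputable def blkFn : List Bool → List Bool := takeFn ∘ fanoutFn fstF (P.f ∘ takeFn ∘ fanoutFn (nthF 1) (nthF 4))

/-- The new component `⟨pad (f block), ε⟩`, cut to `3L + 10`. [folklore] -/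
noncomputable def newFn : List Bool → List Bool :=
  takeFn ∘ fanoutFn (polyFn (3 * X + 10) ∘ fstF) (fanoutFn (pad10Fn ∘ fanoutFn (nthF 2) (blkFn P)) (fun _ => []))

/-- The work of one round (everything after the budget). [folklore] -/
noncomputable def workFn : List Bool → List Bool :=
  fanoutFn (nthF 1) (fanoutFn (nthF 2) (fanoutFn (dropFn ∘ fanoutFn (fun _ => [true]) (nthF 3))
    (fanoutFn (dropFn ∘ fanoutFn (nthF 1) (nthF 4)) (concatFn ∘ fanoutFn (sndPow 4) (newFn P)))))

/-- **One round of the block loop**: identity once the fuel is exhausted. [folklore] -/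
noncomputable def roundFn : List Bool → List Bool :=
  fanoutFn fstF (iteFn (lenLeFn 0 ∘ fanoutFn fstF (nthF 3)) sndF (workFn P))

/-- The output stage: `acc ++ ⟨rest, ε⟩`. [folklore] -/
noncomputable def outFn : List Bool → List Bool := concatFn ∘ fanoutFn (sndPow 4) (fanoutFn (nthF 4) (fun _ => []))

/-- **The whole pipeline.** [folklore] -/
noncomputable def gFn : List Bool → List Bool :=
  outFn ∘ (fun z => (roundFn P)^[X.eval (boolUnpair z).1.length] z) ∘ initFn P L

variable {P L}

/-- The round keeps the first component. [folklore] -/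
theorem roundFn_fst (w : List Bool) : (boolUnpair (roundFn P w)).1 = (boolUnpair w).1 := by
  simp [roundFn, fstF]

/-- **Linear growth of the round on every word.** [folklore] -/
theorem length_roundFn_le (w : List Bool) : (roundFn P w).length ≤ w.length + 20 * ((boolUnpair w).1.length + 1) := by
  have h1 := length_boolUnpair_parts_le w
  have h2 := length_boolUnpair_parts_le (boolUnpair w).2
  have h3 := length_boolUnpair_parts_le (boolUnpair (boolUnpair w).2).2
  have h4 := length_boolUnpair_parts_le (boolUnpair (boolUnpair (boolUnpair w).2).2).2
  have h5 := length_boolUnpair_parts_le (boolUnpair (boolUnpair (boolUnpair (boolUnpair w).2).2).2).2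
  have hnew : (newFn P w).length ≤ 3 * (boolUnpair w).1.length + 10 := by
    simp only [newFn, Function.comp_apply, fanoutFn_apply, takeFn_boolPair, polyFn_apply, List.length_take,
      List.length_replicate, eval_add, eval_mul, eval_ofNat, eval_X, fstF]
    exact min_le_left _ _
  unfold roundFn
  rcases lenLeFn_eq_or 0 (fanoutFn fstF (nthF 3) w) with h | h
  · rw [fanoutFn_apply, iteFn_apply_true (by simpa using h)]
    simp only [length_boolPair, fstF, sndF]; omega
  · rw [fanoutFn_apply, iteFn_apply_false (by simpa using h)]
    have hw : (workFn P w).length ≤ (boolUnpair w).2.length + 8 + (3 * (boolUnpair w).1.length + 10) := by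
      simp only [workFn, fanoutFn_apply, length_boolPair, Function.comp_apply, concatFn_boolPair, List.length_append,
        dropFn_boolPair, List.length_drop, nthF, sndPow, fstF, sndF] at hnew ⊢
      omega
    simp only [length_boolPair, fstF]; omega

/-- `roundFn ∈ FP` for `f ∈ FP`. [folklore] -/
theorem roundFn_mem_FP (hf : PolyTimeComputable id id P.f) : roundFn P ∈ FP := by
  have hblk : blkFn P ∈ FP :=
    comp_mem_FP takeFn_mem_FP (fanoutFn_mem_FP fstF_mem_FP (comp_mem_FP hf (comp_mem_FP takeFn_mem_FP
      (fanoutFn_mem_FP (nthF_mem_FP 1) (nthF_mem_FP 4)))))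
  have hnew : newFn P ∈ FP :=
    comp_mem_FP takeFn_mem_FP (fanoutFn_mem_FP (comp_mem_FP (polyFn_mem_FP _) fstF_mem_FP)
      (fanoutFn_mem_FP (comp_mem_FP pad10Fn_mem_FP (fanoutFn_mem_FP (nthF_mem_FP 2) hblk)) (const_mem_FP [])))
  have hwork : workFn P ∈ FP :=
    fanoutFn_mem_FP (nthF_mem_FP 1) (fanoutFn_mem_FP (nthF_mem_FP 2) (fanoutFn_mem_FP (comp_mem_FP dropFn_mem_FP (fanoutFn_mem_FP (const_mem_FP [true]) (nthF_mem_FP 3)))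
      (fanoutFn_mem_FP (comp_mem_FP dropFn_mem_FP (fanoutFn_mem_FP (nthF_mem_FP 1) (nthF_mem_FP 4)))
        (comp_mem_FP concatFn_mem_FP (fanoutFn_mem_FP (sndPow_mem_FP 4) hnew)))))
  exact fanoutFn_mem_FP fstF_mem_FP (iteFn_mem_FP (comp_mem_FP (lenLeFn_mem_FP 0) (fanoutFn_mem_FP fstF_mem_FP (nthF_mem_FP 3)))
    sndF_mem_FP hwork)

/-- `gFn ∈ FP` for `f ∈ FP`. [folklore] -/
theorem gFn_mem_FP (hf : PolyTimeComputable id id P.f) : gFn P L ∈ FP := by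
  have hinit : initFn P L ∈ FP :=
    fanoutFn_mem_FP (comp_mem_FP (polyFn_mem_FP L) (nOfFn_mem_FP P)) (fanoutFn_mem_FP (nOfFn_mem_FP P)
      (fanoutFn_mem_FP (comp_mem_FP (polyFn_mem_FP _) (nOfFn_mem_FP P))
        (fanoutFn_mem_FP (comp_mem_FP (polyFn_mem_FP _) (nOfFn_mem_FP P)) (fanoutFn_mem_FP OracleCompose.id_mem_FP (const_mem_FP [])))))
  have hout : outFn ∈ FP :=
    comp_mem_FP concatFn_mem_FP (fanoutFn_mem_FP (sndPow_mem_FP 4) (fanoutFn_mem_FP (nthF_mem_FP 4) (const_mem_FP [])))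
  exact comp_mem_FP hout (comp_mem_FP (iterate_mem_FP_of_growth (roundFn_mem_FP hf) 20 roundFn_fst length_roundFn_le X) hinit)

/-! ### Semantics of the pipeline -/

/-- The initial state. [folklore] -/
theorem initFn_apply (w : List Bool) :
    initFn P L w = gState (L.eval (P.nOf w.length)) (P.nOf w.length) (P.p.eval (P.nOf w.length)) (P.T (P.nOf w.length)) w [] := by
  simp [initFn, gState, nOfFn_apply, polyFn_apply]

/-- A round with exhausted fuel is the identity. [folklore] -/
theorem roundFn_gState_zero (Lv n Pn : ℕ) (rest acc : List Bool) :
    roundFn P (gState Lv n Pn 0 rest acc) = gState Lv n Pn 0 rest acc := by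
  unfold roundFn gState
  rw [fanoutFn_apply, fstF_boolPair, iteFn_apply_true, sndF_boolPair]
  simp [lenLeFn_boolPair, ones]

/-- **A round with fuel processes one block** (when no truncation occurs). [folklore] -/
theorem roundFn_gState_succ {Lv n Pn k : ℕ} {rest : List Bool} (acc : List Bool)
    (hf : (P.f (rest.take n)).length ≤ Lv) (hP : 2 * Pn ≤ Lv) (hPn : Pn = P.p.eval n) :
    roundFn P (gState Lv n Pn (k + 1) rest acc) =
      gState Lv n Pn k (rest.drop n) (acc ++ boolPair (P.pad n (P.f (rest.take n))) []) := by
  have hblk : blkFn P (gState Lv n Pn (k + 1) rest acc) = P.f (rest.take n) := by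
    simp only [blkFn, gState, Function.comp_apply, fanoutFn_apply, fstF_boolPair, nthF_succ_boolPair, nthF_zero_boolPair, takeFn_boolPair,
      List.length_replicate]
    exact List.take_of_length_le hf
  have hpad : (P.pad n (P.f (rest.take n))).length ≤ Lv + Pn + 1 := by
    simp only [Params.pad, List.length_append, List.length_cons, List.length_replicate, ← hPn]
    omega
  have hnew : newFn P (gState Lv n Pn (k + 1) rest acc) = boolPair (P.pad n (P.f (rest.take n))) [] := by
    have e1 : newFn P (gState Lv n Pn (k + 1) rest acc) =
        takeFn (boolPair (polyFn (3 * X + 10) (fstF (gState Lv n Pn (k + 1) rest acc)))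
          (boolPair (pad10Fn (boolPair ((nthF 2) (gState Lv n Pn (k + 1) rest acc)) (blkFn P (gState Lv n Pn (k + 1) rest acc)))) [])) := by
      simp only [newFn, Function.comp_apply, fanoutFn_apply]
    rw [e1, hblk]
    simp only [gState, fstF_boolPair, nthF_succ_boolPair, nthF_zero_boolPair, takeFn_boolPair, polyFn_apply, List.length_replicate, eval_add, eval_mul,
      eval_ofNat, eval_X, pad10Fn_boolPair]
    have hpad' : P.pad n (P.f (rest.take n)) = P.f (rest.take n) ++ true :: List.replicate (Pn - (P.f (rest.take n)).length) false := by
      rw [Params.pad, hPn]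
    rw [← hpad']
    apply List.take_of_length_le
    rw [length_boolPair, List.length_nil]
    omega
  unfold roundFn
  rw [fanoutFn_apply, iteFn_apply_false]
  · unfold workFn
    simp only [fanoutFn_apply, Function.comp_apply, hnew]
    simp [gState, List.replicate_succ, concatFn_boolPair]
  · simp [gState, lenLeFn_boolPair, ones]

/-- `comps` grows by one component per block. [folklore] -/
theorem comps_succ (n j : ℕ) (w : List Bool) : P.comps n (j + 1) w = P.comps n j w ++ [P.pad n (P.f (blk n j w))] := by
  simp [Params.comps, List.range_succ]

/-- **Rounds of the block loop** from the initial state: after `j ≤ t` rounds, `j` blocks are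
processed. [folklore] -/
theorem iterate_roundFn {Lv n Pn T : ℕ} {w : List Bool} (hf : ∀ x : List Bool, x.length ≤ n → (P.f x).length ≤ Lv)
    (hP : 2 * Pn ≤ Lv) (hPn : Pn = P.p.eval n) :
    ∀ j, j ≤ T → (roundFn P)^[j] (gState Lv n Pn T w []) = gState Lv n Pn (T - j) (w.drop (n * j)) (frames (P.comps n j w))
  | 0, _ => by simp [Params.comps, frames_nil]
  | j + 1, hj => by
    rw [show n * (j + 1) = n * j + n by ring, Function.iterate_succ_apply', iterate_roundFn hf hP hPn j (by omega),
      show T - j = (T - (j + 1)) + 1 by omega, roundFn_gState_succ _ (hf _ (by simp)) hP hPn, List.drop_drop, comps_succ,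
      frames_append, frames_cons_eq_boolPair, frames_nil, show blk n j w = (w.drop (n * j)).take n by rw [blk, mul_comm]]

/-- Rounds beyond the fuel change nothing. [folklore] -/
theorem iterate_roundFn_of_le {Lv n Pn : ℕ} {rest acc : List Bool} :
    ∀ j, (roundFn P)^[j] (gState Lv n Pn 0 rest acc) = gState Lv n Pn 0 rest acc
  | 0 => rfl
  | j + 1 => by rw [Function.iterate_succ_apply', iterate_roundFn_of_le j, roundFn_gState_zero]

/-- The output stage. [folklore] -/
theorem outFn_gState (Lv n Pn fuel : ℕ) (rest acc : List Bool) :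
    outFn (gState Lv n Pn fuel rest acc) = acc ++ boolPair rest [] := by
  simp [outFn, gState]

/-- **The pipeline computes `g`**, provided the budget polynomial dominates `t`, `2p` and the
output length of `f` on blocks. [folklore] -/
theorem gFn_eq (hT : ∀ n, P.T n ≤ L.eval n) (hP : ∀ n, 2 * P.p.eval n ≤ L.eval n)
    (hf : ∀ (n : ℕ) (x : List Bool), x.length ≤ n → (P.f x).length ≤ L.eval n) (w : List Bool) : gFn P L w = P.g w := by
  set n := P.nOf w.length with hn
  have hsplit : (roundFn P)^[L.eval n] = (roundFn P)^[L.eval n - P.T n] ∘ (roundFn P)^[P.T n] := by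
    rw [← Function.iterate_add, Nat.sub_add_cancel (hT n)]
  simp only [gFn, Function.comp_apply, initFn_apply, ← hn]
  rw [show (boolUnpair (gState (L.eval n) n (P.p.eval n) (P.T n) w [])).1.length = L.eval n by simp [gState], eval_X, hsplit,
    Function.comp_apply, iterate_roundFn (hf n) (hP n) rfl (P.T n) le_rfl, Nat.sub_self, iterate_roundFn_of_le, outFn_gState,
    Params.g, ← hn, frames_append, frames_cons_eq_boolPair, frames_nil]

end GProg

end Yao

/-- **Discharge of `yaoFun_polyTime`**: Yao's direct product `g` is polynomial-time computable for
polynomial-time `f` (and every pair of parameter polynomials `q`, `p`).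
[Goldreich 2001, §2.3.1] [cite: Goldreich2001, Thm. 2.3.2 (proof)] -/
theorem yaoFun_polyTime_holds : yaoFun_polyTime := by
  intro P hf
  obtain ⟨pf, hpf⟩ := Literature.Computability.Complexity.exists_poly_length_le_of_mem_FP hf
  have hmono : ∀ (Q : Polynomial ℕ) {a b : ℕ}, a ≤ b → Q.eval a ≤ Q.eval b := fun Q a b hab => by
    induction Q using Polynomial.induction_on' with
    | add p q hp hq => simpa [Polynomial.eval_add] using Nat.add_le_add hp hq
    | monomial k c => simpa [Polynomial.eval_monomial] using Nat.mul_le_mul_left c (Nat.pow_le_pow_left hab k)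
  set L : Polynomial ℕ := P.Tpoly + Polynomial.C 2 * P.p + pf with hL
  have hfun : P.g = Yao.GProg.gFn P L := by
    funext w
    refine (Yao.GProg.gFn_eq (fun n => ?_) (fun n => ?_) (fun n x hx => ?_) w).symm
    · simp [hL]; omega
    · simp [hL]; omega
    · have h1 := (hpf x).trans (hmono pf hx)
      simp [hL]; omega
  rw [hfun]
  exact Yao.GProg.gFn_mem_FP hf

end Literature.Computability.Cryptography
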